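import Literature.Analysis.Distribution.HormanderEnergyEstimate
import Literature.Analysis.Distribution.SmoothLocality
import HarnessLib

/-!
# Hörmander's Theorem 1.1 from the main estimate (3.4) and Proposition 3.2 (the assembly of §3, PROVED)

Analysis/Distribution support file: the ASSEMBLY of the decomposition of the named fact
`Literature.Analysis.Distribution.Hormander1967_thm11` (`Hypoelliptic.lean`; serving the
provefact unit of
`Literature.MathematicalPhysics.KineticTheory.HeatConduction.CuneoEckmannHairerReyBellet2018_smoothDensity`,
which `LangevinChainHormander.lean` reduces to exactly this fact). L. Hörmander,
*Hypoelliptic second order differential equations*, Acta Math. 119 (1967), §3: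

"It is proved in section 3 that Theorem 1.1 is a consequence of certain a priori estimates"
(p. 150): (3.3) [PROVED, `HormanderEnergyEstimate.lean`] and the main estimate (3.4)
[Theorem 5.1 with Theorem 4.3, §§4–5] give (3.5), and Proposition 3.2 turns (3.5) into
hypoellipticity; Theorem 4.3 is applied where finitely many brackets span
(`T^s(Ω) = T(Ω)`), which under the pointwise hypothesis of Theorem 1.1 is the case near every
point [PROVED, `IsBracketGenerating.exists_hasSpanningBrackets_nhds`], and hypoellipticity is a
local property [PROVED, `SmoothLocality.lean`].

* `Literature.Analysis.Distribution.Hormander1967_thm11_of_mainEstimate_of_prop32` — PROVED: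
  `Hormander1967_thm11` follows from the two deep inputs of the printed proof, taken as
  explicit hypotheses quantified over the data of the fact:
  (h34) **the main estimate (3.4)** — Theorem 5.1 (p. 167) with Theorem 4.3 (p. 159), (4.5)
  and the norm comparison of p. 159: if finitely many iterated brackets of `X₀, (X_j)` span at
  every point of `Ω` then (3.4) holds on the compact subsets of `Ω` with some gain `ε > 0`
  (`MainEstimateOn`); and
  (h32) **Proposition 3.2** (p. 155): if (3.5) holds on the compact subsets of `Ω` with some
  gain `ε > 0` (`APrioriEstimateOn`) then `P` is hypoelliptic in `Ω` (`IsHypoellipticOn`).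

These two hypotheses are NOT vendored as named facts here (D-0026: this is a proving seat for
`CuneoEckmannHairerReyBellet2018_smoothDensity`); they are the recommended split children of
`Hormander1967_thm11` (NOTES of that unit), after which
`Hormander1967_thm11_holds := Hormander1967_thm11_of_mainEstimate_of_prop32 est34_holds prop32_holds`
is one line. Both require substantial theory absent from Mathlib: (3.4) the Hölder norms along
the flows `e^{tX}` and the Campbell–Hausdorff combinatorics of §4 and the smoothing operators
of §5; Prop. 3.2 the regularisation `(1 - δ²Δ)⁻¹`, compactly supported pseudo-differential
operators of symbol `(1 + |ξ|²)^{t/2}` and the Sobolev scale `H^loc_(s)` on `𝓓'(Ω)`.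

## References

* L. Hörmander, *Hypoelliptic second order differential equations*, Acta Math. 119 (1967)
  147–171: p. 150, §3 (3.3)–(3.5), Prop. 3.2 (p. 155), Thm 4.3 (p. 159), Thm 5.1 (p. 167).
-/

noncomputable section

open MeasureTheory TopologicalSpace Set Function Filter Distributions
open scoped ContDiff Topology

namespace Literature.Analysis.Distribution

/-- **Hörmander 1967, Theorem 1.1, from the main estimate (3.4) and Proposition 3.2
(PROVED assembly of §3).** Hypotheses, each quantified over all finite-dimensional real
spaces with a Haar measure, index types, open sets and smooth data:
`h34` — (3.4) = Theorem 5.1 with Theorem 4.3: `HasSpanningBrackets` on `Ω` implies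
`MainEstimateOn μ Ω X₀ X ε` for some `ε > 0`; `h32` — Proposition 3.2: `APrioriEstimateOn
μ Ω X₀ X c ε` for some `ε > 0` implies `IsHypoellipticOn Ω ᵗP μ`. Proof: by locality of
hypoellipticity (`IsHypoellipticOn.of_locally`) it suffices to treat a neighbourhood
`Ω' = W ∩ Ω` of each point on which finitely many brackets span
(`IsBracketGenerating.exists_hasSpanningBrackets_nhds`); there (3.4) holds by `h34`, hence
(3.5) by the proved (3.3) (`APrioriEstimateOn.of_mainEstimateOn`), hence hypoellipticity by
`h32`. [cite: Hormander1967, Thm 1.1] -/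
theorem Hormander1967_thm11_of_mainEstimate_of_prop32
    (h34 : ∀ (E : Type) [NormedAddCommGroup E] [NormedSpace ℝ E] [FiniteDimensional ℝ E]
      [MeasurableSpace E] [BorelSpace E] (μ : Measure E) [μ.IsAddHaarMeasure]
      (ι : Type) [Fintype ι] (Ω : Opens E) (X₀ : E → E) (X : ι → E → E),
      ContDiff ℝ ∞ X₀ → (∀ j, ContDiff ℝ ∞ (X j)) →
      HasSpanningBrackets (fun o : Option ι => o.elim X₀ X) (Ω : Set E) →
      ∃ ε : ℝ, 0 < ε ∧ MainEstimateOn μ Ω X₀ X ε)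
    (h32 : ∀ (E : Type) [NormedAddCommGroup E] [NormedSpace ℝ E] [FiniteDimensional ℝ E]
      [MeasurableSpace E] [BorelSpace E] (μ : Measure E) [μ.IsAddHaarMeasure]
      (ι : Type) [Fintype ι] (Ω : Opens E) (X₀ : E → E) (X : ι → E → E) (c : E → ℝ),
      ContDiff ℝ ∞ X₀ → (∀ j, ContDiff ℝ ∞ (X j)) → ContDiff ℝ ∞ c →
      (∃ ε : ℝ, 0 < ε ∧ APrioriEstimateOn μ Ω X₀ X c ε) →
      IsHypoellipticOn Ω (hormanderTranspose X₀ X c) μ) :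
    Hormander1967_thm11 := by
  intro E _ _ _ _ _ μ _ ι _ Ω X₀ X c hX₀ hX hc hbr
  refine IsHypoellipticOn.of_locally fun x hx => ?_
  have hXo : ∀ o : Option ι, ContDiff ℝ ∞ ((fun o : Option ι => o.elim X₀ X) o) := fun o => by
    cases o with
    | none => exact hX₀
    | some j => exact hX j
  obtain ⟨W, hW, hxW, hWbr⟩ := hbr.exists_hasSpanningBrackets_nhds hXo hx
  let Ω' : Opens E := ⟨W ∩ (Ω : Set E), hW.inter Ω.isOpen⟩
  have hle : Ω' ≤ Ω := fun y hy => hy.2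
  refine ⟨Ω', ⟨hxW, hx⟩, hle, ?_⟩
  have hbr' : HasSpanningBrackets (fun o : Option ι => o.elim X₀ X) (Ω' : Set E) :=
    hWbr.mono fun y hy => hy.1
  obtain ⟨ε, hε, h34'⟩ := h34 E μ ι Ω' X₀ X hX₀ hX hbr'
  exact h32 E μ ι Ω' X₀ X c hX₀ hX hc
    ⟨ε, hε, APrioriEstimateOn.of_mainEstimateOn hX₀ hX hc h34'⟩

end Literature.Analysis.Distribution
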